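import Summits.KontsevichZagierPeriods.KontsevichZagierPeriods.Theses.GammaCornerAnomaly
import Literature.NumberTheory.Transcendental.KZCalculusProofs

/-!
# Crux `MUMSectorComplete` (stmt-KontsevichZagierPeriods-14089) — birth skeleton (`Lines/birth.lean`, BC3)

Route `GammaCornerAnomaly` (route-KontsevichZagierPeriods-GammaCornerAnomaly), rank-9 conjecture-grade
crux `Summit.KontsevichZagierPeriods.KontsevichZagierPeriods.Theses.GammaCornerAnomaly.MUMSectorComplete`
(CLAIMED by the route; antecedent `hS` of its deciding theorem `closes`): CONJECTURE 1 RELATIVE TO THE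
LEGENDRE MUM SECTOR — for representations `r`, `r'` of KZ's literal (rational) shape with equal value,
`[r] − [r'] ∈ closure (↑KZ.relations ∪ (M₂ ∪ M₃))`, where `M₂` is the set of differences `[ρ] − [ρ']` of
the weight-1 Legendre MUM pairs (`ρ ρ' : KZ.IntegralRep 2`, the instances of `LegendreMUMConstant` at
rational `λ ∈ (0,1)`) and `M₃` the set of differences of the weight-2 log-Wronskian pairs
(`ρ ρ' : KZ.IntegralRep 3`, the family `LW λ` of `LegendreLogWronskian`). The route header records:
implied by the summit (`subset_closure ∘ Or.inl`), and with the two sector cruxes giving it (`closes`);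
"its decompositions are the other sector routes' kernels" — no decomposition was filed. No
`Cruxes/MUMSectorComplete/Disproof.lean`, no `Negative/` lemma and no dead line exist for this crux
(`ledger crux ls stmt-KontsevichZagierPeriods-14089`: no workfiles before this one), so there is no
`_false_without_` obstruction to honour.

NB (what forces the shape of the cut). The adjoined MUM differences are NOT tied to a value hypothesis:
`M₂ ∪ M₃ ⊆ ker eval` is the real-analytic content of the two sector cruxes' identities
(`πK′ + K log λ − K log 16 + 2J = 0`, `D(λ) = π²/4`), true but not a theorem of the tree. Hence the
enlarged group `closure (↑relations ∪ (M₂ ∪ M₃))` has NO proved soundness, and a cut of the crux must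
never need `eval` of an element of the enlarged group. The cut below descends by MOVES ALONE (sound:
`KZ.relations_le_ker_eval_holds`) and adjoins the sector only inside the layer where it lives.

## The cut: the SOLID LAYER `S₃` (formal combinations of representations of dimension ≤ 3)

Every element of `M₂ ∪ M₃` is a difference of two representations of dimension `2` or `3`, so the
sector lies in the **solid layer** `S₃ := closure {[s] | s : KZ.IntegralRep k, k ≤ 3}` of the formal
group (PROVED below, `sector_le_solidLayer`). The solid layer is where this route's whole mechanism
acts: the Legendre pencil's periods `K`, `K′`, the log-unfolded `J`, the products `K·K_λ` (2- and
3-dimensional algebraic integrals), `π²` as `∫∫ 4/((1+t²)(1+s²))`, `log 16`, and the weight-3 rung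
`ζ(3)` (Beukers' 3-dimensional rational integrals, `AperyBeukersOne/All`) all live in dimension ≤ 3,
while the weight ≥ 4 Frobenius constants (the non-MZV `κ₄` of Roy–Vlasenko's Table 2, the mirror
quintic's 7-dimensional representations) lie outside it. The skeleton cuts the crux (kernel form)
along `S₃`:

* `stub_solidDescent` (conjecture-grade; implied by the crux — PROVED `solidDescent_of_crux`: the
  enlarged group is `≤ relations ⊔ S₃` — and by the summit with `y = 0`): every vanishing difference
  `[r] − [r']` of RATIONAL representations (any dimensions) is congruent MODULO MOVES ALONE to an
  element `y` of the solid layer: DIMENSION DESCENT of vanishing rational pairs into dimension ≤ 3.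
  Sector-free, hence shared verbatim with every sector route whose sector is supported in dimension
  ≤ 3. It is the part of Conjecture 1 off the layer ("from weight 4 on, Grothendieck-strength
  rigidity": HuberMullerStach2017 Ch. 13; Ayoub2014), in relative form.
* `stub_solidKernel` (conjecture-grade; implied by the crux — PROVED `solidKernel_of_crux`, via the
  tree facts `KZ.exists_integralRep_sub_holds` + `KZ.exists_isRational_equivalent_holds` + soundness of
  the moves): every element of the solid layer with value `0` lies in `closure (↑relations ∪ (M₂ ∪ M₃))`
  — COMPLETENESS OF THE SOLID-LAYER CALCULUS ENLARGED BY THE LEGENDRE MUM PAIRS. This is where the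
  route's informative content sits: the weight-1/weight-2 MUM transition identities of the Legendre
  pencil are exactly the adjoined generators; Legendre's relation, the CM values, the Beukers chain for
  `ζ(3)` and the planar real 1-periods (Huber–Wüstholz) are its first test cases.

Composition `MUMSectorComplete_of : MUMSectorComplete` (real proof; the `suffices` line is literally
`<stub_solidDescent-sig> → <stub_solidKernel-sig> → MUMSectorComplete`, applied to the two stubs by
name — the registry admits no inline `Prop` hypotheses on `<Crux>_of`): `x = [r] − [r']` has
`eval x = 0` (value hypothesis) ↦ descent gives `y ∈ S₃` with `x − y ∈ relations` ↦ soundness OF THE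
MOVES ONLY (`KZ.relations_le_ker_eval_holds`) gives `eval y = 0` ↦ the solid kernel puts `y` in the
enlarged group ↦ so is `x = (x − y) + y` (`relations ≤` enlarged group by `subset_closure ∘ Or.inl`).

Neither stub is cheaply the crux or the summit (BC3 probes in the registrar's folder `bc/probe_*.lean`,
all rc ≠ 0 — quoted in `Lines/birth.md`): `stub_solidKernel → crux` needs descent (open, GPC-strength
in weight ≥ 4) and `stub_solidDescent → crux` needs the solid kernel (open: it contains Legendre's
relation, the CM identities and every real 1-period relation transferred into the moves); neither is
a residual equivalent to the crux modulo proved theorems (the dead-line lesson of the sibling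
relative-completeness crux `CompleteModGammaSector`, stmt-14233: sector levers are absorbed).
Same architecture as the registered birth skeleton of the sibling crux `TorsionSectorComplete`
(stmt-14212, surface layer `S₂`, tied sector); here the layer is `S₃` and, the sector being untied, the
descent is by moves alone.

References: KontsevichZagier2001 §1.2 (Conjecture 1); HuberMullerStach2017 Ch. 13 (Prop. 13.2.6);
Ayoub2014/2015; arXiv:1908.07501 (Bloch–Vlasenko, Cor. 31); arXiv:2206.15181 (Roy–Vlasenko);
HuberWustholz2022 Thm 13.3; CressonViusos2022 §1.
-/

-- `Summit.KontsevichZagierPeriods.KontsevichZagierPeriods.…` is the tree's mandated layout (single-conjunct summit).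
set_option linter.dupNamespace false

open MeasureTheory Set

namespace Summit.KontsevichZagierPeriods.KontsevichZagierPeriods.Cruxes.MUMSectorComplete.Birth

open Literature.NumberTheory.Transcendental
open Literature.NumberTheory.Transcendental.KZ

/-! ### The two registered stubs (the only `sorry`s of this file) -/

/-- **STUB A (`stub_solidDescent`, conjecture-grade) — dimension descent of vanishing rational pairs
into the solid layer, by moves alone.** For representations `r`, `r'` of KZ's literal (rational)
shape, of any dimensions, with `r.value = r'.value`, there is a formal combination `y` of
representations of dimension `≤ 3` (the solid layer `S₃ = closure {[s] | s : KZ.IntegralRep k, k ≤ 3}`,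
algebraic integrands allowed) with `[r] − [r'] − y ∈ KZ.relations`. Implied by the crux
(`solidDescent_of_crux`: the MUM sector lives in `S₃`) and by the summit (`y = 0`); sector-free.
Why it might fail: one rational identity of weight ≥ 4 (an MZV of weight 4, a `κ₄` of a Beauville
pencil, a 7-dimensional mirror-quintic period identity) whose every chain of moves must leave
dimension ≤ 3 for good — it would refute Conjecture 1 outright. Size: conjecture (Grothendieck-strength
rigidity off the layer: HuberMullerStach2017 Ch. 13; Ayoub2014).
[KontsevichZagier2001 §1.2; HuberMullerStach2017 Prop. 13.2.6; arXiv:2206.15181 Table 2] -/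
theorem stub_solidDescent :
    ∀ ⦃n m : ℕ⦄ (r : Literature.NumberTheory.Transcendental.KZ.IntegralRep n)
      (r' : Literature.NumberTheory.Transcendental.KZ.IntegralRep m),
      r.IsRational → r'.IsRational → r.value = r'.value →
      ∃ y ∈ AddSubgroup.closure {c : Literature.NumberTheory.Transcendental.KZ.FormalRep | ∃ (k : ℕ) (s : Literature.NumberTheory.Transcendental.KZ.IntegralRep k), k ≤ 3 ∧ c = Literature.NumberTheory.Transcendental.KZ.of s},
        Literature.NumberTheory.Transcendental.KZ.of r - Literature.NumberTheory.Transcendental.KZ.of r' - y ∈ Literature.NumberTheory.Transcendental.KZ.relations := by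
  sorry

/-- **STUB B (`stub_solidKernel`, conjecture-grade) — completeness of the solid-layer calculus enlarged
by the Legendre MUM pairs.** Every element of the solid layer `closure {[s] | s : KZ.IntegralRep k, k ≤ 3}`
whose value is `0` lies in `closure (↑KZ.relations ∪ (M₂ ∪ M₃))` (`M₂`, `M₃` verbatim the two MUM
difference sets of the crux). Implied by the crux (`solidKernel_of_crux`: merge to a difference of two
representations, rationalise both, read the value equation off soundness of the moves, apply the
crux). Why it might fail: one identity inside the layer — Legendre's relation at a rational modulus, a
CM value `K(λ_CM)/π ∈ ℚ̄·Γ-monomial`, a Huber–Wüstholz relation among real 1-periods, the Beukers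
value `∫P/Q² = 2(5ζ(3) − 6)` — that is no chain of real semialgebraic moves even granted the MUM
pairs; it would refute the crux and the summit with it. Size: conjecture (period conjecture for pairs
of dimension ≤ 3 inside the rules, the Legendre MUM identities adjoined).
[KontsevichZagier2001 §1.2; HuberWustholz2022 Thm 13.3; arXiv:1908.07501 Cor. 31; doi:10.1112/blms/11.3.268] -/
theorem stub_solidKernel :
    ∀ y ∈ AddSubgroup.closure {c : Literature.NumberTheory.Transcendental.KZ.FormalRep | ∃ (k : ℕ) (s : Literature.NumberTheory.Transcendental.KZ.IntegralRep k), k ≤ 3 ∧ c = Literature.NumberTheory.Transcendental.KZ.of s},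
      Literature.NumberTheory.Transcendental.KZ.eval y = 0 →
        y ∈ AddSubgroup.closure ((Literature.NumberTheory.Transcendental.KZ.relations : Set Literature.NumberTheory.Transcendental.KZ.FormalRep) ∪ ({d : Literature.NumberTheory.Transcendental.KZ.FormalRep | ∃ (l : ℚ) (ρ ρ' : Literature.NumberTheory.Transcendental.KZ.IntegralRep 2), 0 < l ∧ l < 1 ∧ ρ.domain = {q | ∀ i, q i ∈ Set.Ioo (0:ℝ) 1} ∧ Set.EqOn ρ.integrand (fun q => (((q 1 * (1 - q 1) * (1 - (l:ℝ) * q 0 * q 1)) ^ (-(1:ℝ)/2) - (q 1 * (1 - q 1) * (1 - (l:ℝ) * q 0 ^ 2 * q 1)) ^ (-(1:ℝ)/2)) / (1 - q 0))) ρ.domain ∧ ρ'.domain = {q | ∀ i, q i ∈ Set.Ioo (0:ℝ) 1} ∧ Set.EqOn ρ'.integrand (fun q => (-(2 / (1 + q 0 ^ 2)) * ((q 1 * (1 - q 1) * (1 - (1 - (l:ℝ)) * q 1)) ^ (-(1:ℝ)/2) / 2) + (3 / (1 + 3 * q 0) + (1 - (l:ℝ)) / (2 * ((l:ℝ) + (1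 - (l:ℝ)) * q 0))) * ((q 1 * (1 - q 1) * (1 - (l:ℝ) * q 1)) ^ (-(1:ℝ)/2) / 2))) ρ'.domain ∧ d = Literature.NumberTheory.Transcendental.KZ.of ρ - Literature.NumberTheory.Transcendental.KZ.of ρ'} ∪ {d : Literature.NumberTheory.Transcendental.KZ.FormalRep | ∃ (l : ℚ) (ρ ρ' : Literature.NumberTheory.Transcendental.KZ.IntegralRep 3), 0 < l ∧ l < 1 ∧ ρ.domain = {p | ∀ i, p i ∈ Set.Ioo (0:ℝ) 1} ∧ Set.EqOn ρ.integrand (fun p => ((1 - (l:ℝ)) * ((p 1 * (1 - p 1) * (1 - (l:ℝ) * p 1)) ^ (-(1:ℝ)/2) / 2) * ((p 2 * (1 - p 2) * (1 - (l:ℝ) * p 2)) ^ (-(1:ℝ)/2) / 2) - 2 * (l:ℝ) * (1 - (l:ℝ)) * ((((p 1 * (1 - p 1) * (1 - (l:ℝ) * p 0 * p 1)) ^ (-(1:ℝ)/2) - (p 1 * (1 - p 1) * (1 - (l:ℝ) * p 0 ^ 2 * p 1)) ^ (-(1:ℝ)/2)) / (1 - p 0)) * (p 2 * (p 2 * (1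 - p 2) * (1 - (l:ℝ) * p 2)) ^ (-(1:ℝ)/2) / (4 * (1 - (l:ℝ) * p 2))) - ((p 0 * p 1 * (p 1 * (1 - p 1) * (1 - (l:ℝ) * p 0 * p 1)) ^ (-(1:ℝ)/2) / (2 * (1 - (l:ℝ) * p 0 * p 1)) - p 0 ^ 2 * p 1 * (p 1 * (1 - p 1) * (1 - (l:ℝ) * p 0 ^ 2 * p 1)) ^ (-(1:ℝ)/2) / (2 * (1 - (l:ℝ) * p 0 ^ 2 * p 1))) / (1 - p 0)) * ((p 2 * (1 - p 2) * (1 - (l:ℝ) * p 2)) ^ (-(1:ℝ)/2) / 2)))) ρ.domain ∧ ρ'.domain = {p | ∀ i, p i ∈ Set.Ioo (0:ℝ) 1} ∧ Set.EqOn ρ'.integrand (fun p => 4 / ((1 + p 1 ^ 2) * (1 + p 2 ^ 2))) ρ'.domain ∧ d = Literature.NumberTheory.Transcendental.KZ.of ρ - Literature.NumberTheory.Transcendental.KZ.of ρ'})) := by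
  sorry

/-! ### Proved infrastructure of the cut (no `sorry` below this line) -/

/-- **The sector lives in the solid layer, so the enlarged group is `≤ relations ⊔ S₃`.** Every MUM
difference is `[ρ] − [ρ']` with `ρ ρ'` of dimension `2` (weight 1) or `3` (weight 2).
[KontsevichZagier2001 §1.2] -/
theorem sector_le_solidLayer :
    AddSubgroup.closure ((Literature.NumberTheory.Transcendental.KZ.relations : Set Literature.NumberTheory.Transcendental.KZ.FormalRep) ∪ ({d : Literature.NumberTheory.Transcendental.KZ.FormalRep | ∃ (l : ℚ) (ρ ρ' : Literature.NumberTheory.Transcendental.KZ.IntegralRep 2), 0 < l ∧ l < 1 ∧ ρ.domain = {q | ∀ i, q i ∈ Set.Ioo (0:ℝ) 1} ∧ Set.EqOn ρ.integrand (fun q => (((q 1 * (1 - q 1) * (1 - (l:ℝ) * q 0 * q 1)) ^ (-(1:ℝ)/2) - (q 1 * (1 - q 1) * (1 - (l:ℝ) * q 0 ^ 2 * q 1)) ^ (-(1:ℝ)/2)) / (1 - q 0))) ρ.domain ∧ ρ'.domain = {q | ∀ i, q i ∈ Set.Ioo (0:ℝ) 1} ∧ Set.EqOn ρ'.integrand (fun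 q => (-(2 / (1 + q 0 ^ 2)) * ((q 1 * (1 - q 1) * (1 - (1 - (l:ℝ)) * q 1)) ^ (-(1:ℝ)/2) / 2) + (3 / (1 + 3 * q 0) + (1 - (l:ℝ)) / (2 * ((l:ℝ) + (1 - (l:ℝ)) * q 0))) * ((q 1 * (1 - q 1) * (1 - (l:ℝ) * q 1)) ^ (-(1:ℝ)/2) / 2))) ρ'.domain ∧ d = Literature.NumberTheory.Transcendental.KZ.of ρ - Literature.NumberTheory.Transcendental.KZ.of ρ'} ∪ {d : Literature.NumberTheory.Transcendental.KZ.FormalRep | ∃ (l : ℚ) (ρ ρ' : Literature.NumberTheory.Transcendental.KZ.IntegralRep 3), 0 < l ∧ l < 1 ∧ ρ.domain = {p | ∀ i, p i ∈ Set.Ioo (0:ℝ) 1} ∧ Set.EqOn ρ.integrand (fun p => ((1 - (l:ℝ)) * ((p 1 * (1 - p 1) * (1 - (l:ℝ) * p 1)) ^ (-(1:ℝ)/2) / 2) * ((p 2 * (1 - p 2) * (1 - (l:ℝ) * p 2)) ^ (-(1:ℝ)/2) / 2) - 2 * (l:ℝ) * (1 - (l:ℝ)) * ((((p 1 * (1 -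 p 1) * (1 - (l:ℝ) * p 0 * p 1)) ^ (-(1:ℝ)/2) - (p 1 * (1 - p 1) * (1 - (l:ℝ) * p 0 ^ 2 * p 1)) ^ (-(1:ℝ)/2)) / (1 - p 0)) * (p 2 * (p 2 * (1 - p 2) * (1 - (l:ℝ) * p 2)) ^ (-(1:ℝ)/2) / (4 * (1 - (l:ℝ) * p 2))) - ((p 0 * p 1 * (p 1 * (1 - p 1) * (1 - (l:ℝ) * p 0 * p 1)) ^ (-(1:ℝ)/2) / (2 * (1 - (l:ℝ) * p 0 * p 1)) - p 0 ^ 2 * p 1 * (p 1 * (1 - p 1) * (1 - (l:ℝ) * p 0 ^ 2 * p 1)) ^ (-(1:ℝ)/2) / (2 * (1 - (l:ℝ) * p 0 ^ 2 * p 1))) / (1 - p 0)) * ((p 2 * (1 - p 2) * (1 - (l:ℝ) * p 2)) ^ (-(1:ℝ)/2) / 2)))) ρ.domain ∧ ρ'.domain = {p | ∀ i, p i ∈ Set.Ioo (0:ℝ) 1} ∧ Set.EqOn ρ'.integrand (fun p => 4 / ((1 + p 1 ^ 2) * (1 + p 2 ^ 2))) ρ'.domain ∧ d = Literature.NumberTheory.Transcendental.KZ.of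 ρ - Literature.NumberTheory.Transcendental.KZ.of ρ'})) ≤
      Literature.NumberTheory.Transcendental.KZ.relations ⊔ AddSubgroup.closure {c : Literature.NumberTheory.Transcendental.KZ.FormalRep | ∃ (k : ℕ) (s : Literature.NumberTheory.Transcendental.KZ.IntegralRep k), k ≤ 3 ∧ c = Literature.NumberTheory.Transcendental.KZ.of s} := by
  refine (AddSubgroup.closure_le _).mpr ?_
  rintro d (hd | ⟨l, ρ, ρ', -, -, -, -, -, -, rfl⟩ | ⟨l, ρ, ρ', -, -, -, -, -, -, rfl⟩)
  · exact AddSubgroup.mem_sup_left hd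
  · exact AddSubgroup.mem_sup_right
      (AddSubgroup.sub_mem _ (AddSubgroup.subset_closure ⟨2, ρ, by norm_num, rfl⟩)
        (AddSubgroup.subset_closure ⟨2, ρ', by norm_num, rfl⟩))
  · exact AddSubgroup.mem_sup_right
      (AddSubgroup.sub_mem _ (AddSubgroup.subset_closure ⟨3, ρ, le_rfl, rfl⟩)
        (AddSubgroup.subset_closure ⟨3, ρ', le_rfl, rfl⟩))

/-- **Stub A is crux-implied**: the crux puts `x = [r] − [r']` in the enlarged group, which is
`≤ relations ⊔ S₃` (`sector_le_solidLayer`); split `x = a + y` with `a ∈ relations`, `y ∈ S₃`.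
So `stub_solidDescent` is refutable only by refuting the crux (hence the summit).
[KontsevichZagier2001 §1.2] -/
theorem solidDescent_of_crux
    (hC : Summit.KontsevichZagierPeriods.KontsevichZagierPeriods.Theses.GammaCornerAnomaly.MUMSectorComplete) :
    ∀ ⦃n m : ℕ⦄ (r : Literature.NumberTheory.Transcendental.KZ.IntegralRep n)
      (r' : Literature.NumberTheory.Transcendental.KZ.IntegralRep m),
      r.IsRational → r'.IsRational → r.value = r'.value →
      ∃ y ∈ AddSubgroup.closure {c : Literature.NumberTheory.Transcendental.KZ.FormalRep | ∃ (k : ℕ) (s : Literature.NumberTheory.Transcendental.KZ.IntegralRep k), k ≤ 3 ∧ c = Literature.NumberTheory.Transcendental.KZ.of s},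
        Literature.NumberTheory.Transcendental.KZ.of r - Literature.NumberTheory.Transcendental.KZ.of r' - y ∈ Literature.NumberTheory.Transcendental.KZ.relations := by
  intro n m r r' hr hr' hv
  obtain ⟨a, ha, y, hy, hay⟩ := AddSubgroup.mem_sup.mp (sector_le_solidLayer (hC r r' hr hr' hv))
  refine ⟨y, hy, ?_⟩
  have : of r - of r' - y = a := by rw [← hay]; abel
  rw [this]
  exact ha

/-- **Stub B is crux-implied** (in fact for every formal combination of value `0`, not only the
solid layer): merge `y ≡ [r] − [r']` (`exists_integralRep_sub_holds`), rationalise `r ~ r₁`,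
`r' ~ r₁'` (`exists_isRational_equivalent_holds`), read `r₁.value = r₁'.value` off soundness of the
moves (`relations_le_ker_eval_holds`), apply the crux to the rational pair and climb back through
`relations ≤ closure (↑relations ∪ _)`. [KontsevichZagier2001 §1.1 (remark) and §1.2] -/
theorem solidKernel_of_crux
    (hC : Summit.KontsevichZagierPeriods.KontsevichZagierPeriods.Theses.GammaCornerAnomaly.MUMSectorComplete) :
    ∀ y ∈ AddSubgroup.closure {c : Literature.NumberTheory.Transcendental.KZ.FormalRep | ∃ (k : ℕ) (s : Literature.NumberTheory.Transcendental.KZ.IntegralRep k), k ≤ 3 ∧ c = Literature.NumberTheory.Transcendental.KZ.of s},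
      Literature.NumberTheory.Transcendental.KZ.eval y = 0 →
        y ∈ AddSubgroup.closure ((Literature.NumberTheory.Transcendental.KZ.relations : Set Literature.NumberTheory.Transcendental.KZ.FormalRep) ∪ ({d : Literature.NumberTheory.Transcendental.KZ.FormalRep | ∃ (l : ℚ) (ρ ρ' : Literature.NumberTheory.Transcendental.KZ.IntegralRep 2), 0 < l ∧ l < 1 ∧ ρ.domain = {q | ∀ i, q i ∈ Set.Ioo (0:ℝ) 1} ∧ Set.EqOn ρ.integrand (fun q => (((q 1 * (1 - q 1) * (1 - (l:ℝ) * q 0 * q 1)) ^ (-(1:ℝ)/2) - (q 1 * (1 - q 1) * (1 - (l:ℝ) * q 0 ^ 2 * q 1)) ^ (-(1:ℝ)/2)) / (1 - q 0))) ρ.domain ∧ ρ'.domain = {q | ∀ i, q i ∈ Set.Ioo (0:ℝ) 1} ∧ Set.EqOn ρ'.integrand (fun q => (-(2 / (1 + q 0 ^ 2)) * ((q 1 * (1 - q 1) * (1 - (1 - (l:ℝ)) * q 1)) ^ (-(1:ℝ)/2) / 2) + (3 / (1 + 3 * q 0) + (1 - (l:ℝ)) / (2 * ((l:ℝ) + (1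 - (l:ℝ)) * q 0))) * ((q 1 * (1 - q 1) * (1 - (l:ℝ) * q 1)) ^ (-(1:ℝ)/2) / 2))) ρ'.domain ∧ d = Literature.NumberTheory.Transcendental.KZ.of ρ - Literature.NumberTheory.Transcendental.KZ.of ρ'} ∪ {d : Literature.NumberTheory.Transcendental.KZ.FormalRep | ∃ (l : ℚ) (ρ ρ' : Literature.NumberTheory.Transcendental.KZ.IntegralRep 3), 0 < l ∧ l < 1 ∧ ρ.domain = {p | ∀ i, p i ∈ Set.Ioo (0:ℝ) 1} ∧ Set.EqOn ρ.integrand (fun p => ((1 - (l:ℝ)) * ((p 1 * (1 - p 1) * (1 - (l:ℝ) * p 1)) ^ (-(1:ℝ)/2) / 2) * ((p 2 * (1 - p 2) * (1 - (l:ℝ) * p 2)) ^ (-(1:ℝ)/2) / 2) - 2 * (l:ℝ) * (1 - (l:ℝ)) * ((((p 1 * (1 - p 1) * (1 - (l:ℝ) * p 0 * p 1)) ^ (-(1:ℝ)/2) - (p 1 * (1 - p 1) * (1 - (l:ℝ) * p 0 ^ 2 * p 1)) ^ (-(1:ℝ)/2)) / (1 - p 0)) * (p 2 * (p 2 * (1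 - p 2) * (1 - (l:ℝ) * p 2)) ^ (-(1:ℝ)/2) / (4 * (1 - (l:ℝ) * p 2))) - ((p 0 * p 1 * (p 1 * (1 - p 1) * (1 - (l:ℝ) * p 0 * p 1)) ^ (-(1:ℝ)/2) / (2 * (1 - (l:ℝ) * p 0 * p 1)) - p 0 ^ 2 * p 1 * (p 1 * (1 - p 1) * (1 - (l:ℝ) * p 0 ^ 2 * p 1)) ^ (-(1:ℝ)/2) / (2 * (1 - (l:ℝ) * p 0 ^ 2 * p 1))) / (1 - p 0)) * ((p 2 * (1 - p 2) * (1 - (l:ℝ) * p 2)) ^ (-(1:ℝ)/2) / 2)))) ρ.domain ∧ ρ'.domain = {p | ∀ i, p i ∈ Set.Ioo (0:ℝ) 1} ∧ Set.EqOn ρ'.integrand (fun p => 4 / ((1 + p 1 ^ 2) * (1 + p 2 ^ 2))) ρ'.domain ∧ d = Literature.NumberTheory.Transcendental.KZ.of ρ - Literature.NumberTheory.Transcendental.KZ.of ρ'})) := by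
  intro y _hy hy0
  set H : AddSubgroup Literature.NumberTheory.Transcendental.KZ.FormalRep :=
    AddSubgroup.closure ((Literature.NumberTheory.Transcendental.KZ.relations : Set Literature.NumberTheory.Transcendental.KZ.FormalRep) ∪ ({d : Literature.NumberTheory.Transcendental.KZ.FormalRep | ∃ (l : ℚ) (ρ ρ' : Literature.NumberTheory.Transcendental.KZ.IntegralRep 2), 0 < l ∧ l < 1 ∧ ρ.domain = {q | ∀ i, q i ∈ Set.Ioo (0:ℝ) 1} ∧ Set.EqOn ρ.integrand (fun q => (((q 1 * (1 - q 1) * (1 - (l:ℝ) * q 0 * q 1)) ^ (-(1:ℝ)/2) - (q 1 * (1 - q 1) * (1 - (l:ℝ) * q 0 ^ 2 * q 1)) ^ (-(1:ℝ)/2)) / (1 - q 0))) ρ.domain ∧ ρ'.domain = {q | ∀ i, q i ∈ Set.Ioo (0:ℝ) 1} ∧ Set.EqOn ρ'.integrand (fun q => (-(2 / (1 + q 0 ^ 2)) * ((q 1 * (1 - q 1) * (1 - (1 - (l:ℝ)) * q 1)) ^ (-(1:ℝ)/2) / 2) + (3 / (1 + 3 * q 0) + (1 - (l:ℝ)) /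 (2 * ((l:ℝ) + (1 - (l:ℝ)) * q 0))) * ((q 1 * (1 - q 1) * (1 - (l:ℝ) * q 1)) ^ (-(1:ℝ)/2) / 2))) ρ'.domain ∧ d = Literature.NumberTheory.Transcendental.KZ.of ρ - Literature.NumberTheory.Transcendental.KZ.of ρ'} ∪ {d : Literature.NumberTheory.Transcendental.KZ.FormalRep | ∃ (l : ℚ) (ρ ρ' : Literature.NumberTheory.Transcendental.KZ.IntegralRep 3), 0 < l ∧ l < 1 ∧ ρ.domain = {p | ∀ i, p i ∈ Set.Ioo (0:ℝ) 1} ∧ Set.EqOn ρ.integrand (fun p => ((1 - (l:ℝ)) * ((p 1 * (1 - p 1) * (1 - (l:ℝ) * p 1)) ^ (-(1:ℝ)/2) / 2) * ((p 2 * (1 - p 2) * (1 - (l:ℝ) * p 2)) ^ (-(1:ℝ)/2) / 2) - 2 * (l:ℝ) * (1 - (l:ℝ)) * ((((p 1 * (1 - p 1) * (1 - (l:ℝ) * p 0 * p 1)) ^ (-(1:ℝ)/2) - (p 1 * (1 - p 1) * (1 - (l:ℝ) * p 0 ^ 2 * p 1)) ^ (-(1:ℝ)/2)) / (1 - p 0))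 * (p 2 * (p 2 * (1 - p 2) * (1 - (l:ℝ) * p 2)) ^ (-(1:ℝ)/2) / (4 * (1 - (l:ℝ) * p 2))) - ((p 0 * p 1 * (p 1 * (1 - p 1) * (1 - (l:ℝ) * p 0 * p 1)) ^ (-(1:ℝ)/2) / (2 * (1 - (l:ℝ) * p 0 * p 1)) - p 0 ^ 2 * p 1 * (p 1 * (1 - p 1) * (1 - (l:ℝ) * p 0 ^ 2 * p 1)) ^ (-(1:ℝ)/2) / (2 * (1 - (l:ℝ) * p 0 ^ 2 * p 1))) / (1 - p 0)) * ((p 2 * (1 - p 2) * (1 - (l:ℝ) * p 2)) ^ (-(1:ℝ)/2) / 2)))) ρ.domain ∧ ρ'.domain = {p | ∀ i, p i ∈ Set.Ioo (0:ℝ) 1} ∧ Set.EqOn ρ'.integrand (fun p => 4 / ((1 + p 1 ^ 2) * (1 + p 2 ^ 2))) ρ'.domain ∧ d = Literature.NumberTheory.Transcendental.KZ.of ρ - Literature.NumberTheory.Transcendental.KZ.of ρ'})) with hH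
  have hRel : Literature.NumberTheory.Transcendental.KZ.relations ≤ H :=
    fun d hd => AddSubgroup.subset_closure (Or.inl hd)
  -- merge: `y ≡ [r] − [r']` modulo moves
  obtain ⟨n, m, r, r', hmerge⟩ := exists_integralRep_sub_holds y
  -- rationalise both ends
  obtain ⟨n₁, r₁, hr₁, he₁⟩ := exists_isRational_equivalent_holds r
  obtain ⟨m₁, r₁', hr₁', he₁'⟩ := exists_isRational_equivalent_holds r'
  have hdiff : y - (of r₁ - of r₁') ∈ Literature.NumberTheory.Transcendental.KZ.relations := by
    have : y - (of r₁ - of r₁') = (y - (of r - of r')) + (of r - of r₁) - (of r' - of r₁') := by abel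
    rw [this]
    exact relations.sub_mem (relations.add_mem hmerge he₁) he₁'
  have hv : r₁.value = r₁'.value := by
    have h0 : Literature.NumberTheory.Transcendental.KZ.eval (y - (of r₁ - of r₁')) = 0 :=
      relations_le_ker_eval_holds hdiff
    rw [map_sub, map_sub, eval_of, eval_of, hy0, zero_sub, neg_sub, sub_eq_zero] at h0
    exact h0.symm
  have hpair : of r₁ - of r₁' ∈ H := hC r₁ r₁' hr₁ hr₁' hv
  have : y = (y - (of r₁ - of r₁')) + (of r₁ - of r₁') := by abel
  rw [this]
  exact H.add_mem (hRel hdiff) hpair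

/-! ### Composition (the registered implication, kernel-checked) -/

/-- **Composition: the crux BY NAME from the two stubs.** The `suffices` is the registered
implication `<stub_solidDescent> → <stub_solidKernel> → MUMSectorComplete` (closed term, no `sorry`
of its own), applied to the two named stubs. Proof: for rational `r`, `r'` of equal value put
`x = [r] − [r']`, so `eval x = 0`; descent gives `y ∈ S₃` with `x − y ∈ relations`; soundness of the
MOVES (`relations_le_ker_eval_holds`; no soundness of the adjoined pairs is used) gives `eval y = 0`;
the solid kernel gives `y ∈ closure (↑relations ∪ (M₂ ∪ M₃))`; hence so is `x = (x − y) + y`.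
Axioms: the Mathlib whitelist plus `sorryAx` through the two stubs only. [KontsevichZagier2001 §1.2] -/
theorem MUMSectorComplete_of :
    Summit.KontsevichZagierPeriods.KontsevichZagierPeriods.Theses.GammaCornerAnomaly.MUMSectorComplete := by
  suffices key :
      (∀ ⦃n m : ℕ⦄ (r : Literature.NumberTheory.Transcendental.KZ.IntegralRep n)
      (r' : Literature.NumberTheory.Transcendental.KZ.IntegralRep m),
      r.IsRational → r'.IsRational → r.value = r'.value →
      ∃ y ∈ AddSubgroup.closure {c : Literature.NumberTheory.Transcendental.KZ.FormalRep | ∃ (k : ℕ) (s : Literature.NumberTheory.Transcendental.KZ.IntegralRep k), k ≤ 3 ∧ c = Literature.NumberTheory.Transcendental.KZ.of s},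
        Literature.NumberTheory.Transcendental.KZ.of r - Literature.NumberTheory.Transcendental.KZ.of r' - y ∈ Literature.NumberTheory.Transcendental.KZ.relations) →
      (∀ y ∈ AddSubgroup.closure {c : Literature.NumberTheory.Transcendental.KZ.FormalRep | ∃ (k : ℕ) (s : Literature.NumberTheory.Transcendental.KZ.IntegralRep k), k ≤ 3 ∧ c = Literature.NumberTheory.Transcendental.KZ.of s},
      Literature.NumberTheory.Transcendental.KZ.eval y = 0 →
        y ∈ AddSubgroup.closure ((Literature.NumberTheory.Transcendental.KZ.relations : Set Literature.NumberTheory.Transcendental.KZ.FormalRep) ∪ ({d : Literature.NumberTheory.Transcendental.KZ.FormalRep | ∃ (l : ℚ) (ρ ρ' : Literature.NumberTheory.Transcendental.KZ.IntegralRep 2), 0 < l ∧ l < 1 ∧ ρ.domain = {q | ∀ i, q i ∈ Set.Ioo (0:ℝ) 1} ∧ Set.EqOn ρ.integrand (fun q => (((q 1 * (1 - q 1) * (1 - (l:ℝ) * q 0 * q 1)) ^ (-(1:ℝ)/2) - (q 1 * (1 - q 1) * (1 - (l:ℝ) * q 0 ^ 2 * q 1)) ^ (-(1:ℝ)/2))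 / (1 - q 0))) ρ.domain ∧ ρ'.domain = {q | ∀ i, q i ∈ Set.Ioo (0:ℝ) 1} ∧ Set.EqOn ρ'.integrand (fun q => (-(2 / (1 + q 0 ^ 2)) * ((q 1 * (1 - q 1) * (1 - (1 - (l:ℝ)) * q 1)) ^ (-(1:ℝ)/2) / 2) + (3 / (1 + 3 * q 0) + (1 - (l:ℝ)) / (2 * ((l:ℝ) + (1 - (l:ℝ)) * q 0))) * ((q 1 * (1 - q 1) * (1 - (l:ℝ) * q 1)) ^ (-(1:ℝ)/2) / 2))) ρ'.domain ∧ d = Literature.NumberTheory.Transcendental.KZ.of ρ - Literature.NumberTheory.Transcendental.KZ.of ρ'} ∪ {d : Literature.NumberTheory.Transcendental.KZ.FormalRep | ∃ (l : ℚ) (ρ ρ' : Literature.NumberTheory.Transcendental.KZ.IntegralRep 3), 0 < l ∧ l < 1 ∧ ρ.domain = {p | ∀ i, p i ∈ Set.Ioo (0:ℝ) 1} ∧ Set.EqOn ρ.integrand (fun p => ((1 - (l:ℝ)) * ((p 1 * (1 - p 1) * (1 - (l:ℝ) * p 1)) ^ (-(1:ℝ)/2) / 2) * ((p 2 * (1 -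 p 2) * (1 - (l:ℝ) * p 2)) ^ (-(1:ℝ)/2) / 2) - 2 * (l:ℝ) * (1 - (l:ℝ)) * ((((p 1 * (1 - p 1) * (1 - (l:ℝ) * p 0 * p 1)) ^ (-(1:ℝ)/2) - (p 1 * (1 - p 1) * (1 - (l:ℝ) * p 0 ^ 2 * p 1)) ^ (-(1:ℝ)/2)) / (1 - p 0)) * (p 2 * (p 2 * (1 - p 2) * (1 - (l:ℝ) * p 2)) ^ (-(1:ℝ)/2) / (4 * (1 - (l:ℝ) * p 2))) - ((p 0 * p 1 * (p 1 * (1 - p 1) * (1 - (l:ℝ) * p 0 * p 1)) ^ (-(1:ℝ)/2) / (2 * (1 - (l:ℝ) * p 0 * p 1)) - p 0 ^ 2 * p 1 * (p 1 * (1 - p 1) * (1 - (l:ℝ) * p 0 ^ 2 * p 1)) ^ (-(1:ℝ)/2) / (2 * (1 - (l:ℝ) * p 0 ^ 2 * p 1))) / (1 - p 0)) * ((p 2 * (1 - p 2) * (1 - (l:ℝ) * p 2)) ^ (-(1:ℝ)/2) / 2)))) ρ.domain ∧ ρ'.domain = {p | ∀ i, p i ∈ Set.Ioo (0:ℝ)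 1} ∧ Set.EqOn ρ'.integrand (fun p => 4 / ((1 + p 1 ^ 2) * (1 + p 2 ^ 2))) ρ'.domain ∧ d = Literature.NumberTheory.Transcendental.KZ.of ρ - Literature.NumberTheory.Transcendental.KZ.of ρ'}))) →
      Summit.KontsevichZagierPeriods.KontsevichZagierPeriods.Theses.GammaCornerAnomaly.MUMSectorComplete from
    key stub_solidDescent stub_solidKernel
  intro hA hB n m r r' hr hr' hv
  -- descent into the solid layer, by moves alone
  obtain ⟨y, hy, hxy⟩ := hA r r' hr hr' hv
  -- the pair vanishes
  have hx0 : Literature.NumberTheory.Transcendental.KZ.eval (of r - of r') = 0 := by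
    rw [map_sub, eval_of, eval_of, hv, sub_self]
  -- soundness of the moves: the solid remainder vanishes too
  have hy0 : Literature.NumberTheory.Transcendental.KZ.eval y = 0 := by
    have h : Literature.NumberTheory.Transcendental.KZ.eval (of r - of r' - y) = 0 := relations_le_ker_eval_holds hxy
    rwa [map_sub, hx0, zero_sub, neg_eq_zero] at h
  -- the solid kernel, then climb back
  have hyH := hB y hy hy0
  have : of r - of r' = (of r - of r' - y) + y := by abel
  rw [this]
  exact AddSubgroup.add_mem _ (AddSubgroup.subset_closure (Or.inl hxy)) hyH

end Summit.KontsevichZagierPeriods.KontsevichZagierPeriods.Cruxes.MUMSectorComplete.Birth
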